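import Literature.NumberTheory.Sieve.IwaniecAlmostPrimesWCount
import HarnessLib

/-!
# Iwaniec (1978), §4: the evaluations of `V` and `W` against the common main term — PROVED

H. Iwaniec, *Almost-primes represented by quadratic polynomials*, Invent. Math. 47 (1978)
171–188, §4 pp. 181–184 (proof of Proposition 1, the dispersion `𝒟 = W − 2xV + x²U`).

This file evaluates, for one pair `(n₁, n₂)` of squarefree moduli and the `m`-range
`Msf = {A' < m ≤ B₀ : (m, n₁ n₂) = 1}`, the two sums
* `V(n) = ∑_{m ∈ Msf} ∑_{v root mod m} X_n(m, v)/m` (`vsum`), and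
* `W(n₁, n₂) = ∑_{m ∈ Msf} ∑_{v} X_{n₁}(m, v) X_{n₂}(m, v)` (`wsum`),
against their main terms, *two-sidedly* and in the "`m`-first" form in which the main terms
are finite sums over `m` (so that in the assembly the main terms of `W`, `xV`, `x²U` cancel
exactly against `κ · ∑_m 1/m²`):
* `vsum_bounds`: `e κ ∑_{A'<m≤B₀} ⌊X/m⌋/m − (L+1)Err/(A'+1) ≤ V ≤ e κ ∑_m (⌊X/m⌋+1)/m + (L+1)Err/(A'+1)`;
* `wsum_bounds`: `(ρ(q)/q) κ ∑_m ∑_{l₁,l₂<⌊X/m⌋} g − (L+1)² τ(d) wErr ≤ W ≤ (ρ(q)/q) κ ∑_m ∑_{l₁,l₂≤⌊X/m⌋} g + (L+1)² τ(d) wErr`,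
  `g(l₁,l₂) = [d₂ odd]/φ(d₂)`, `d₂ = d/(d, |l₁−l₂|)`, `q = [n₁,n₂]`, `d = (n₁,n₂)` (`gfun`, `wErr`).

Method (pp. 182–184): for each `m` the count is sandwiched between sums over the layers
`l = ⌊k/m⌋` (`IwaniecAlmostPrimesDispersion`: `congrCount_le_sum_wcount`, `sum_xcount_mul_le`, …);
after interchanging `m` and `l` each layer is a window count of the corrected Lemma 4
(`windowSum_inv_linear`, `windowCount_linear` of `IwaniecAlmostPrimesLinearModel`), for `W` through
the `d₂`-analysis of `IwaniecAlmostPrimesWCount` (`sum_wpair_eq_sum_windowCount`, the `ρ(d₂)`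
admissible classes `card_admissible_eq`, `ρ(q/d₂)ρ(d₂) = ρ(q)`); the main terms are then
re-summed over `l` first.  Everything here is proved (given `lemma6_hooley` as a hypothesis where
Lemma 4 enters).
-/

noncomputable section

open Finset Real

namespace Literature.NumberTheory.Sieve.Iwaniec1978

/-! ### The `m`-ranges cut off by `(l + θ) m ≤ X` -/

/-- The upper endpoint of the `m`-range for the `l`-th layer (upper sandwich): `B₀` for `l = 0`,
`min(B₀, ⌊X/l⌋)` otherwise. [cite: IwaniecInventiones1978, §4 p. 182] -/
def bPlus (B₀ X l : ℕ) : ℕ := if l = 0 then B₀ else min B₀ (X / l)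

/-- The upper endpoint for the lower sandwich: `min(B₀, ⌊X/(l+1)⌋)`. [cite: IwaniecInventiones1978, §4 p. 182] -/
def bMinus (B₀ X l : ℕ) : ℕ := min B₀ (X / (l + 1))

/-- `bPlus ≤ B₀`. [folklore] -/
theorem bPlus_le (B₀ X l : ℕ) : bPlus B₀ X l ≤ B₀ := by
  unfold bPlus; split_ifs <;> omega

/-- `bMinus ≤ B₀`. [folklore] -/
theorem bMinus_le (B₀ X l : ℕ) : bMinus B₀ X l ≤ B₀ := by
  unfold bMinus; omega

/-- `{A < m ≤ B₀ : l < X/m + 1} = (A, bPlus]`. [folklore] -/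
theorem filter_Ioc_lt_div_add_one (A B₀ X l : ℕ) :
    (Finset.Ioc A B₀).filter (fun m => l < X / m + 1) = Finset.Ioc A (bPlus B₀ X l) := by
  ext m
  simp only [Finset.mem_filter, Finset.mem_Ioc, bPlus]
  constructor
  · rintro ⟨⟨h1, h2⟩, h3⟩
    refine ⟨h1, ?_⟩
    split_ifs with hl
    · exact h2
    · rw [lt_div_add_one_iff (by omega : 0 < m)] at h3
      refine le_min h2 ?_
      rw [Nat.le_div_iff_mul_le (by omega)]
      rw [mul_comm]; exact h3
  · rintro ⟨h1, h2⟩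
    split_ifs at h2 with hl
    · subst hl
      exact ⟨⟨h1, h2⟩, Nat.zero_lt_succ _⟩
    · have h2' := le_min_iff.mp h2
      refine ⟨⟨h1, h2'.1⟩, ?_⟩
      rw [lt_div_add_one_iff (by omega : 0 < m)]
      have := h2'.2
      rw [Nat.le_div_iff_mul_le (by omega)] at this
      rw [mul_comm]; exact this

/-- `{A < m ≤ B₀ : l < X/m} = (A, bMinus]`. [folklore] -/
theorem filter_Ioc_lt_div (A B₀ X l : ℕ) :
    (Finset.Ioc A B₀).filter (fun m => l < X / m) = Finset.Ioc A (bMinus B₀ X l) := by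
  ext m
  simp only [Finset.mem_filter, Finset.mem_Ioc, bMinus]
  constructor
  · rintro ⟨⟨h1, h2⟩, h3⟩
    refine ⟨h1, le_min h2 ?_⟩
    rw [lt_div_iff_succ_mul_le (by omega : 0 < m)] at h3
    rw [Nat.le_div_iff_mul_le (by omega), mul_comm]; exact h3
  · rintro ⟨h1, h2⟩
    have h2' := le_min_iff.mp h2
    refine ⟨⟨h1, h2'.1⟩, ?_⟩
    rw [lt_div_iff_succ_mul_le (by omega : 0 < m)]
    have := h2'.2
    rw [Nat.le_div_iff_mul_le (by omega)] at this
    rw [mul_comm]; exact this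

/-! ### The window fibres with `d = 1` -/

/-- With `d = 1`, `μ = ω = 0`: `windowFibre q Q 1 0 0 c m = [(m,Q)=1] · wcount m q c`. [folklore] -/
theorem windowFibre_one (q Q c m : ℕ) :
    windowFibre q Q 1 0 0 c m = if m.Coprime Q then wcount m q c else 0 := by
  unfold windowFibre wcount
  by_cases h : m.Coprime Q
  · rw [if_pos ⟨h, Nat.modEq_one⟩, if_pos h]
    congr 1
    exact Finset.filter_congr fun Θ _ => ⟨fun hh => hh.2, fun hh => ⟨Nat.modEq_one, hh⟩⟩
  · rw [if_neg (fun hh => h hh.1), if_neg h]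

/-- The `l`-th layer of `V` as a weighted window sum over the family with `d = 1`. [folklore] -/
theorem sum_wcount_div_eq_family (q Q A t c : ℕ) :
    ∑ m ∈ (Finset.Ioc A t).filter (fun m : ℕ => m.Coprime Q), (wcount m q c : ℝ) / m =
      ∑ p ∈ (lemma4Family q Q 1 0 0 A t).filter (fun p : ℕ × ℕ => p.2 / p.1 = c), (1 : ℝ) / p.1 := by
  have h := sum_window_family_eq q Q 1 0 0 A t c (fun m => (1 : ℝ) / m)
  rw [h, Finset.sum_filter]
  refine Finset.sum_congr rfl fun m _ => ?_
  rw [windowFibre_one]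
  split_ifs <;> simp [div_eq_mul_inv]

/-! ### The evaluation of `V` -/

/-- **`V` against its main term, upper and lower bounds** (p. 182, (13)–(14), in the `m`-first
form): with `Msf = {A' < m ≤ B₀ : (m, Q) = 1}`, `e = ρ(n)/n`, `κ = kappa Q G E`,
`Err = windowErr C ε n Q 1 0 A' B₀ E`, `L = ⌊X/(A'+1)⌋`:
`vsum X Msf n ≤ e κ ∑_{A'<m≤B₀} (⌊X/m⌋+1)/m + (L+1) Err/(A'+1)` and
`e κ ∑_{A'<m≤B₀} ⌊X/m⌋/m − (L+1) Err/(A'+1) ≤ vsum X Msf n`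
(per layer `l`: the window `⌊Θ/m⌋ = l mod n` of Lemma 4 with the weight `1/m`,
`windowSum_inv_linear`; the two sandwiches of `IwaniecAlmostPrimesDispersion.lean`).
[cite: IwaniecInventiones1978, §4 p. 182] -/
theorem vsum_bounds (h6 : lemma6_hooley) {ε : ℝ} (hε : 0 < ε) :
    ∃ C : ℝ, 0 ≤ C ∧ ∀ (X n Q A' B₀ E G : ℕ), Squarefree Q → n ∣ Q → 2 ≤ A' → A' ≤ B₀ →
      1 ≤ E → E ≤ A' → Nat.sqrt B₀ ≤ G →
      (vsum X ((Finset.Ioc A' B₀).filter (fun m : ℕ => m.Coprime Q)) n ≤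
          (rho n : ℝ) / n * kappa Q G E * ∑ m ∈ Finset.Ioc A' B₀, (((X / m + 1 : ℕ) : ℝ)) / m +
            ((X / (A' + 1) + 1 : ℕ) : ℝ) * windowErr C ε n Q 1 0 A' B₀ E / (A' + 1)) ∧
      ((rho n : ℝ) / n * kappa Q G E * ∑ m ∈ Finset.Ioc A' B₀, (((X / m : ℕ) : ℝ)) / m -
            ((X / (A' + 1) + 1 : ℕ) : ℝ) * windowErr C ε n Q 1 0 A' B₀ E / (A' + 1) ≤
          vsum X ((Finset.Ioc A' B₀).filter (fun m : ℕ => m.Coprime Q)) n) := by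
  obtain ⟨C, hC0, hC⟩ := windowSum_inv_linear h6 hε
  refine ⟨C, hC0, ?_⟩
  intro X n Q A' B₀ E G hQ hnQ hA hAB hE hEA hG
  have hQ0 : Q ≠ 0 := hQ.ne_zero
  have hn : 0 < n := Nat.pos_of_dvd_of_pos hnQ (Nat.pos_of_ne_zero hQ0)
  set Msf := (Finset.Ioc A' B₀).filter (fun m : ℕ => m.Coprime Q) with hMsf
  set e : ℝ := (rho n : ℝ) / n with he
  set κ : ℝ := kappa Q G E with hκ
  set Err : ℝ := windowErr C ε n Q 1 0 A' B₀ E with hErr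
  set Lmax : ℕ := X / (A' + 1) with hLmax
  have hMs_pos : ∀ m ∈ Msf, 0 < m := by
    intro m hm; rw [hMsf, Finset.mem_filter, Finset.mem_Ioc] at hm; omega
  -- Step 1: `V = ∑_m |𝒜_{mn}|/m`
  have hV : vsum X Msf n = ∑ m ∈ Msf, (congrCount (X : ℝ) (m * n) : ℝ) / m := by
    unfold vsum
    refine Finset.sum_congr rfl fun m hm => ?_
    have hm0 := hMs_pos m hm
    rw [hMsf, Finset.mem_filter] at hm
    have hmn : m.Coprime n := Nat.Coprime.coprime_dvd_right hnQ hm.2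
    rw [congrCount_mul_eq_sum_xcount (X : ℝ) hm0 hmn, Nat.floor_natCast, Nat.cast_sum,
      Finset.sum_div]
  -- the per-layer estimate
  have hlayer : ∀ (l t : ℕ), t ≤ B₀ →
      |∑ m ∈ (Finset.Ioc A' t).filter (fun m : ℕ => m.Coprime Q), (wcount m n (l % n) : ℝ) / m -
          e * κ * ∑ m ∈ Finset.Ioc A' t, (1 : ℝ) / m| ≤ Err / (A' + 1) := by
    intro l t htB
    rcases le_or_gt A' t with hAt | hAt
    · rw [sum_wcount_div_eq_family]
      have h := (hC n Q 1 0 0 A' t (l % n) E G hQ hnQ (one_dvd n) (by norm_num)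
        (Nat.coprime_one_right 0) (by norm_num) hA hAt (Nat.mod_lt l hn) hE hEA
        ((Nat.sqrt_le_sqrt htB).trans hG)).2
      rw [Nat.div_one, Nat.totient_one, Nat.cast_one, div_one] at h
      have hmono : windowErr C ε n Q 1 0 A' t E ≤ Err := windowErr_mono hC0 hε.le hE htB
      have hA1 : (0 : ℝ) < A' + 1 := by positivity
      calc _ ≤ windowErr C ε n Q 1 0 A' t E / (A' + 1) := by
            convert h using 3; rw [he, hκ]; ring
        _ ≤ Err / (A' + 1) := div_le_div_of_nonneg_right hmono hA1.le
    · have h1 : Finset.Ioc A' t = ∅ := Finset.Ioc_eq_empty (by omega)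
      rw [h1, Finset.filter_empty, Finset.sum_empty, Finset.sum_empty, mul_zero, sub_zero, abs_zero]
      have : 0 ≤ Err := by
        rw [hErr]
        have h := (hC n Q 1 0 0 A' B₀ (l % n) E G hQ hnQ (one_dvd n) (by norm_num)
          (Nat.coprime_one_right 0) (by norm_num) hA hAB (Nat.mod_lt l hn) hE hEA hG).1
        exact (abs_nonneg _).trans h
      positivity
  have hL : ∀ m ∈ Msf, X / m + 1 ≤ Lmax + 1 := by
    intro m hm
    rw [hMsf, Finset.mem_filter, Finset.mem_Ioc] at hm
    exact Nat.succ_le_succ (Nat.div_le_div_left (by omega) (by omega))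
  have hL' : ∀ m ∈ Msf, X / m ≤ Lmax + 1 := fun m hm => (Nat.le_succ _).trans (hL m hm)
  have hLall : ∀ m ∈ Finset.Ioc A' B₀, X / m + 1 ≤ Lmax + 1 := by
    intro m hm
    rw [Finset.mem_Ioc] at hm
    exact Nat.succ_le_succ (Nat.div_le_div_left (by omega) (by omega))
  have hLall' : ∀ m ∈ Finset.Ioc A' B₀, X / m ≤ Lmax + 1 := fun m hm => (Nat.le_succ _).trans (hLall m hm)
  -- the filtered `m`-ranges of the layers
  have hfilP : ∀ l, Msf.filter (fun m => l < X / m + 1) =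
      (Finset.Ioc A' (bPlus B₀ X l)).filter (fun m : ℕ => m.Coprime Q) := by
    intro l
    rw [hMsf, Finset.filter_filter, ← filter_Ioc_lt_div_add_one A' B₀ X l, Finset.filter_filter]
    exact Finset.filter_congr fun m _ => and_comm
  have hfilM : ∀ l, Msf.filter (fun m => l < X / m) =
      (Finset.Ioc A' (bMinus B₀ X l)).filter (fun m : ℕ => m.Coprime Q) := by
    intro l
    rw [hMsf, Finset.filter_filter, ← filter_Ioc_lt_div A' B₀ X l, Finset.filter_filter]
    exact Finset.filter_congr fun m _ => and_comm
  constructor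
  · -- Upper bound
    have hVle : vsum X Msf n ≤ ∑ m ∈ Msf, ∑ l ∈ Finset.range (X / m + 1), (wcount m n (l % n) : ℝ) / m := by
      rw [hV]
      refine Finset.sum_le_sum fun m hm => ?_
      have hm0 := hMs_pos m hm
      rw [← Finset.sum_div]
      refine div_le_div_of_nonneg_right ?_ (Nat.cast_nonneg _)
      have := congrCount_le_sum_wcount (X : ℝ) (m := m) hm0 hn
      rw [Nat.floor_natCast] at this
      exact_mod_cast this
    refine hVle.trans ?_
    rw [sum_sum_range_comm Msf (fun m => X / m + 1) hL]
    have hmain : ∑ m ∈ Finset.Ioc A' B₀, (((X / m + 1 : ℕ) : ℝ)) / m =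
        ∑ l ∈ Finset.range (Lmax + 1), ∑ m ∈ Finset.Ioc A' (bPlus B₀ X l), (1 : ℝ) / m := by
      have : ∀ m ∈ Finset.Ioc A' B₀, (((X / m + 1 : ℕ) : ℝ)) / m =
          ∑ l ∈ Finset.range (X / m + 1), (1 : ℝ) / m := by
        intro m _; rw [Finset.sum_const, Finset.card_range, nsmul_eq_mul]; ring
      rw [Finset.sum_congr rfl this, sum_sum_range_comm (Finset.Ioc A' B₀) (fun m => X / m + 1) hLall]
      refine Finset.sum_congr rfl fun l _ => ?_
      rw [filter_Ioc_lt_div_add_one]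
    rw [hmain, Finset.mul_sum]
    have hstep : ∀ l ∈ Finset.range (Lmax + 1),
        ∑ m ∈ Msf.filter (fun m => l < X / m + 1), (wcount m n (l % n) : ℝ) / m ≤
          e * κ * ∑ m ∈ Finset.Ioc A' (bPlus B₀ X l), (1 : ℝ) / m + Err / (A' + 1) := by
      intro l _
      rw [hfilP l]
      have h := hlayer l (bPlus B₀ X l) (bPlus_le B₀ X l)
      have := (abs_le.mp h).2
      linarith
    calc ∑ l ∈ Finset.range (Lmax + 1), ∑ m ∈ Msf.filter (fun m => l < X / m + 1),
          (wcount m n (l % n) : ℝ) / m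
        ≤ ∑ l ∈ Finset.range (Lmax + 1),
          (e * κ * ∑ m ∈ Finset.Ioc A' (bPlus B₀ X l), (1 : ℝ) / m + Err / (A' + 1)) :=
          Finset.sum_le_sum hstep
      _ = _ := by
          rw [Finset.sum_add_distrib, Finset.sum_const, Finset.card_range, nsmul_eq_mul]
          push_cast
          ring
  · -- Lower bound
    have hVge : ∑ m ∈ Msf, ∑ l ∈ Finset.range (X / m), (wcount m n (l % n) : ℝ) / m ≤ vsum X Msf n := by
      rw [hV]
      refine Finset.sum_le_sum fun m hm => ?_
      have hm0 := hMs_pos m hm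
      have hm2 : 2 ≤ m := by rw [hMsf, Finset.mem_filter, Finset.mem_Ioc] at hm; omega
      rw [← Finset.sum_div]
      refine div_le_div_of_nonneg_right ?_ (Nat.cast_nonneg _)
      have := sum_wcount_le_congrCount (X : ℝ) (m := m) hm2 hn
      rw [Nat.floor_natCast] at this
      exact_mod_cast this
    refine le_trans ?_ hVge
    rw [sum_sum_range_comm Msf (fun m => X / m) hL']
    have hmain : ∑ m ∈ Finset.Ioc A' B₀, (((X / m : ℕ) : ℝ)) / m =
        ∑ l ∈ Finset.range (Lmax + 1), ∑ m ∈ Finset.Ioc A' (bMinus B₀ X l), (1 : ℝ) / m := by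
      have : ∀ m ∈ Finset.Ioc A' B₀, (((X / m : ℕ) : ℝ)) / m =
          ∑ l ∈ Finset.range (X / m), (1 : ℝ) / m := by
        intro m _; rw [Finset.sum_const, Finset.card_range, nsmul_eq_mul]; ring
      rw [Finset.sum_congr rfl this, sum_sum_range_comm (Finset.Ioc A' B₀) (fun m => X / m) hLall']
      refine Finset.sum_congr rfl fun l _ => ?_
      rw [filter_Ioc_lt_div]
    rw [hmain, Finset.mul_sum]
    have hstep : ∀ l ∈ Finset.range (Lmax + 1),
        e * κ * ∑ m ∈ Finset.Ioc A' (bMinus B₀ X l), (1 : ℝ) / m - Err / (A' + 1) ≤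
          ∑ m ∈ Msf.filter (fun m => l < X / m), (wcount m n (l % n) : ℝ) / m := by
      intro l _
      rw [hfilM l]
      have h := hlayer l (bMinus B₀ X l) (bMinus_le B₀ X l)
      have := (abs_le.mp h).1
      linarith
    calc ∑ l ∈ Finset.range (Lmax + 1), e * κ * ∑ m ∈ Finset.Ioc A' (bMinus B₀ X l), (1 : ℝ) / m -
          ((Lmax + 1 : ℕ) : ℝ) * Err / (A' + 1)
        = ∑ l ∈ Finset.range (Lmax + 1),
          (e * κ * ∑ m ∈ Finset.Ioc A' (bMinus B₀ X l), (1 : ℝ) / m - Err / (A' + 1)) := by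
          rw [Finset.sum_sub_distrib, Finset.sum_const, Finset.card_range, nsmul_eq_mul]
          push_cast
          ring
      _ ≤ _ := Finset.sum_le_sum hstep

/-! ### Helpers for `W`: `ρ ≤ τ`, vanishing window counts, a `μ`-uniform error -/

/-- `ρ(n) ≤ τ(n)` (multiplicativity and `ρ(p^a) ≤ 2 ≤ a + 1`). [folklore] -/
theorem rho_le_card_divisors (n : ℕ) : rho n ≤ n.divisors.card := by
  induction n using Nat.recOnPosPrimePosCoprime with
  | prime_pow p a hp ha =>
    calc rho (p ^ a) ≤ 2 := rho_primePow_le_two hp ha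
      _ ≤ a + 1 := by omega
      _ = (p ^ a).divisors.card := by rw [Nat.divisors_prime_pow hp, Finset.card_map, Finset.card_range]
  | zero => simp [rho_zero]
  | one => simp [rho_one]
  | coprime m n hm hn hmn ihm ihn =>
    rw [rho_mul_of_coprime (by omega) (by omega) hmn, Nat.Coprime.card_divisors_mul hmn]
    exact Nat.mul_le_mul ihm ihn

/-- A window count vanishes unless `μ` is prime to `d` … [folklore] -/
theorem windowCount_eq_zero_of_not_coprime {q Q d μ ω A t c : ℕ} (hdQ : d ∣ Q)
    (h : ¬ μ.Coprime d) : windowCount q Q d μ ω A t c = 0 := by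
  unfold windowCount
  rw [Finset.card_eq_zero, Finset.filter_eq_empty_iff]
  intro p hp _
  rw [mem_lemma4Family] at hp
  apply h
  have h1 : p.1.Coprime d := Nat.Coprime.coprime_dvd_right hdQ hp.2.1
  rw [Nat.Coprime, ← Nat.ModEq.gcd_eq hp.2.2.1]
  exact h1

/-- … and unless `ω` is a root modulo `d`. [folklore] -/
theorem windowCount_eq_zero_of_not_root {q Q d μ ω A t c : ℕ} (hdq : d ∣ q)
    (h : ¬ d ∣ ω ^ 2 + 1) : windowCount q Q d μ ω A t c = 0 := by
  unfold windowCount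
  rw [Finset.card_eq_zero, Finset.filter_eq_empty_iff]
  intro p hp _
  rw [mem_lemma4Family, mem_rootsNat] at hp
  apply h
  have h1 : d ∣ p.2 ^ 2 + 1 := (hdq.trans (dvd_mul_left q p.1)).trans hp.2.2.2.1.2
  have h2 : p.2 ^ 2 + 1 ≡ ω ^ 2 + 1 [MOD d] := (hp.2.2.2.2.pow 2).add_right 1
  exact Nat.modEq_zero_iff_dvd.mp (h2.symm.trans (Nat.modEq_zero_iff_dvd.mpr h1))

/-- `Σ₀(t; Q, d, μ) ≤ Σ₀(t; Q, 1, 0)` (a sub-sum). [folklore] -/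
theorem rhoSumAP_le_rhoSumAP_one (t Q d μ : ℕ) : rhoSumAP t Q d μ ≤ rhoSumAP t Q 1 0 := by
  unfold rhoSumAP
  refine Finset.sum_le_sum_of_subset_of_nonneg ?_ fun _ _ _ => Nat.zero_le _
  intro m hm
  rw [Finset.mem_filter] at hm ⊢
  exact ⟨hm.1, hm.2.1, Nat.modEq_one⟩

/-- The `μ`- and `t`-uniform error for the `W`-windows of the pair `(q, d)`:
`4ρ(q)Σ₀(B₀)/A'^{1/4} + C d (∑_{l∣q} ρ(lq)) (1+log 16A')² S₀^{1/2+ε} S₀ + (2/q)ρ(q)(2τ(q)+7)(√B₀√E + B₀/E)`,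
`S₀ = ⌊√(B₀ q)⌋`. [cite: IwaniecInventiones1978, §4 p. 184] -/
def wErr (C ε : ℝ) (q d A' B₀ E : ℕ) : ℝ :=
  4 * (rho q : ℝ) * (rhoSumAP B₀ q 1 0 : ℝ) / (A' : ℝ) ^ (1 / 4 : ℝ) +
    C * d * (∑ l ∈ q.divisors, (rho (l * q) : ℝ)) * (1 + Real.log (16 * A')) ^ 2 *
      ((Nat.sqrt (B₀ * q) : ℝ) ^ (1 / 2 + ε) * Nat.sqrt (B₀ * q)) +
    2 / q * (rho q : ℝ) * ((2 * q.divisors.card + 7) * (Real.sqrt B₀ * Real.sqrt E + B₀ / E))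

/-- `windowErr` for an admissible class (`d₂ ∣ d`, `d₂ ∣ q`, `ρ(d₂) ≥ 1`, `t ≤ B₀`) is at most
`wErr`. [folklore] -/
theorem windowErr_le_wErr {C ε : ℝ} (hC : 0 ≤ C) (hε : 0 ≤ ε) {q d d₂ μ A' t B₀ E : ℕ}
    (hq : Squarefree q) (hd : 0 < d) (hd₂d : d₂ ∣ d) (hd₂q : d₂ ∣ q) (hρ : 1 ≤ rho d₂)
    (hE : 1 ≤ E) (ht : t ≤ B₀) : windowErr C ε q q d₂ μ A' t E ≤ wErr C ε q d A' B₀ E := by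
  have hq0 : q ≠ 0 := hq.ne_zero
  have hρq : (rho (q / d₂) : ℝ) ≤ rho q := by
    have h := rho_div_mul_rho hq hd₂q
    have : rho (q / d₂) * 1 ≤ rho (q / d₂) * rho d₂ := Nat.mul_le_mul_left _ hρ
    rw [mul_one, h] at this
    exact_mod_cast this
  have hSig : (rhoSumAP t q d₂ μ : ℝ) ≤ rhoSumAP B₀ q 1 0 := by
    exact_mod_cast (rhoSumAP_le_rhoSumAP_one t q d₂ μ).trans (rhoSumAP_mono ht q 1 0)
  have hdd : (d₂ : ℝ) ≤ d := by exact_mod_cast Nat.le_of_dvd hd hd₂d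
  have hS : (Nat.sqrt (t * q) : ℝ) ≤ Nat.sqrt (B₀ * q) := by
    exact_mod_cast Nat.sqrt_le_sqrt (Nat.mul_le_mul_right q ht)
  have hS0 : (0 : ℝ) ≤ Nat.sqrt (t * q) := Nat.cast_nonneg _
  have hS' : (Nat.sqrt (t * q) : ℝ) ^ (1 / 2 + ε) ≤ (Nat.sqrt (B₀ * q) : ℝ) ^ (1 / 2 + ε) :=
    Real.rpow_le_rpow hS0 hS (by linarith)
  have ht' : (t : ℝ) ≤ B₀ := by exact_mod_cast ht
  have hsq : Real.sqrt t ≤ Real.sqrt B₀ := Real.sqrt_le_sqrt ht'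
  have hE0 : (0 : ℝ) < E := by exact_mod_cast hE
  have hA : 0 ≤ (A' : ℝ) ^ (1 / 4 : ℝ) := Real.rpow_nonneg (Nat.cast_nonneg _) _
  have hR : 0 ≤ ∑ l ∈ q.divisors, (rho (l * q) : ℝ) :=
    Finset.sum_nonneg fun _ _ => Nat.cast_nonneg _
  have hρ0 : (0 : ℝ) ≤ rho (q / d₂) := Nat.cast_nonneg _
  have hSig0 : (0 : ℝ) ≤ rhoSumAP t q d₂ μ := Nat.cast_nonneg _
  have hL : (0 : ℝ) ≤ (1 + Real.log (16 * A')) ^ 2 := sq_nonneg _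
  have h1 : 4 * (rho (q / d₂) : ℝ) * (rhoSumAP t q d₂ μ : ℝ) / (A' : ℝ) ^ (1 / 4 : ℝ) ≤
      4 * (rho q : ℝ) * (rhoSumAP B₀ q 1 0 : ℝ) / (A' : ℝ) ^ (1 / 4 : ℝ) := by
    apply div_le_div_of_nonneg_right _ hA
    exact mul_le_mul (mul_le_mul_of_nonneg_left hρq (by norm_num)) hSig hSig0 (by positivity)
  have h2 : C * d₂ * (∑ l ∈ q.divisors, (rho (l * q) : ℝ)) * (1 + Real.log (16 * A')) ^ 2 *
        ((Nat.sqrt (t * q) : ℝ) ^ (1 / 2 + ε) * Nat.sqrt (t * q)) ≤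
      C * d * (∑ l ∈ q.divisors, (rho (l * q) : ℝ)) * (1 + Real.log (16 * A')) ^ 2 *
        ((Nat.sqrt (B₀ * q) : ℝ) ^ (1 / 2 + ε) * Nat.sqrt (B₀ * q)) := by
    have hP0 : (0 : ℝ) ≤ (Nat.sqrt (t * q) : ℝ) ^ (1 / 2 + ε) * Nat.sqrt (t * q) :=
      mul_nonneg (Real.rpow_nonneg hS0 _) hS0
    have hP : (Nat.sqrt (t * q) : ℝ) ^ (1 / 2 + ε) * Nat.sqrt (t * q) ≤
        (Nat.sqrt (B₀ * q) : ℝ) ^ (1 / 2 + ε) * Nat.sqrt (B₀ * q) :=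
      mul_le_mul hS' hS hS0 (Real.rpow_nonneg (Nat.cast_nonneg _) _)
    have hK : C * d₂ * (∑ l ∈ q.divisors, (rho (l * q) : ℝ)) * (1 + Real.log (16 * A')) ^ 2 ≤
        C * d * (∑ l ∈ q.divisors, (rho (l * q) : ℝ)) * (1 + Real.log (16 * A')) ^ 2 :=
      mul_le_mul_of_nonneg_right (mul_le_mul_of_nonneg_right
        (mul_le_mul_of_nonneg_left hdd hC) hR) hL
    have hK0 : 0 ≤ C * d * (∑ l ∈ q.divisors, (rho (l * q) : ℝ)) * (1 + Real.log (16 * A')) ^ 2 :=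
      mul_nonneg (mul_nonneg (mul_nonneg hC (Nat.cast_nonneg _)) hR) hL
    exact mul_le_mul hK hP hP0 hK0
  have h3 : 2 / q * (rho (q / d₂) : ℝ) *
        ((2 * q.divisors.card + 7) * (Real.sqrt t * Real.sqrt E + t / E)) ≤
      2 / q * (rho q : ℝ) * ((2 * q.divisors.card + 7) * (Real.sqrt B₀ * Real.sqrt E + B₀ / E)) := by
    have hq2 : (0 : ℝ) ≤ 2 / q := by positivity
    have hin : Real.sqrt t * Real.sqrt E + t / E ≤ Real.sqrt B₀ * Real.sqrt E + B₀ / E :=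
      add_le_add (mul_le_mul_of_nonneg_right hsq (Real.sqrt_nonneg _))
        (div_le_div_of_nonneg_right ht' hE0.le)
    have hin0 : 0 ≤ Real.sqrt t * Real.sqrt E + t / E := by positivity
    have hτ : (0 : ℝ) ≤ 2 * q.divisors.card + 7 := by positivity
    exact mul_le_mul (mul_le_mul_of_nonneg_left hρq hq2) (mul_le_mul_of_nonneg_left hin hτ)
      (mul_nonneg hτ hin0) (mul_nonneg hq2 (Nat.cast_nonneg _))
  unfold windowErr wErr
  exact add_le_add (add_le_add h1 h2) h3

/-- `wErr ≥ 0`. [folklore] -/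
theorem wErr_nonneg {C : ℝ} (hC : 0 ≤ C) (ε : ℝ) (q d A' B₀ E : ℕ) : 0 ≤ wErr C ε q d A' B₀ E := by
  unfold wErr; positivity

/-! ### The per-`(l₁, l₂)` linear model for the `W`-counts -/

/-- `g(l₁, l₂) = [d₂ odd]/φ(d₂)`, `d₂ = d/(d, |l₁ − l₂|)`: the density of the `W`-count of the pair
`(l₁, l₂)` relative to `ρ(q)κ/q` (p. 183). [cite: IwaniecInventiones1978, §4 p. 183] -/
def gfun (d l₁ l₂ : ℕ) : ℝ :=
  if 2 ∣ dtwo d l₁ l₂ then 0 else 1 / (Nat.totient (dtwo d l₁ l₂) : ℝ)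

/-- `g ≥ 0`. [folklore] -/
theorem gfun_nonneg (d l₁ l₂ : ℕ) : 0 ≤ gfun d l₁ l₂ := by
  unfold gfun; split_ifs <;> positivity

/-- **The `W`-count of a pair `(l₁, l₂)` over `A' < m ≤ t` against its linear model** (p. 183–184):
with `q = [n₁, n₂]`, `d = (n₁, n₂)`,
`|∑_{A'<m≤t, (m,n₁n₂)=1} wpair(m; l₁, l₂) − (ρ(q)/q) κ g(l₁, l₂) (t − A')| ≤ τ(d) · wErr`
(sum over the `ρ(d₂) ≤ τ(d)` admissible classes `μ mod d₂` of the window counts of Lemma 4,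
`ρ(q/d₂)ρ(d₂) = ρ(q)`). [cite: IwaniecInventiones1978, §4 pp. 183–184] -/
theorem sum_wpair_linear (h6 : lemma6_hooley) {ε : ℝ} (hε : 0 < ε) :
    ∃ C : ℝ, 0 ≤ C ∧ ∀ (n₁ n₂ A' B₀ t E G l₁ l₂ : ℕ), Squarefree n₁ → Squarefree n₂ → 2 ≤ A' →
      t ≤ B₀ → 1 ≤ E → E ≤ A' → Nat.sqrt B₀ ≤ G →
      |∑ m ∈ (Finset.Ioc A' t).filter (fun m : ℕ => n₁.Coprime m ∧ n₂.Coprime m),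
          (wpair m n₁ n₂ l₁ l₂ : ℝ) -
        (rho (Nat.lcm n₁ n₂) : ℝ) / Nat.lcm n₁ n₂ * kappa (Nat.lcm n₁ n₂) G E *
          gfun (Nat.gcd n₁ n₂) l₁ l₂ * (((t - A' : ℕ) : ℝ))| ≤
      ((Nat.gcd n₁ n₂).divisors.card : ℝ) * wErr C ε (Nat.lcm n₁ n₂) (Nat.gcd n₁ n₂) A' B₀ E := by
  obtain ⟨C, hC0, hC⟩ := windowSum_inv_linear h6 hε
  refine ⟨C, hC0, ?_⟩
  intro n₁ n₂ A' B₀ t E G l₁ l₂ hn₁ hn₂ hA htB hE hEA hG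
  have hn₁0 : n₁ ≠ 0 := hn₁.ne_zero
  have hRHS : 0 ≤ ((Nat.gcd n₁ n₂).divisors.card : ℝ) *
      wErr C ε (Nat.lcm n₁ n₂) (Nat.gcd n₁ n₂) A' B₀ E :=
    mul_nonneg (Nat.cast_nonneg _) (wErr_nonneg hC0 ε _ _ A' B₀ E)
  rcases lt_or_ge t A' with hAt | hAt
  · have h1 : Finset.Ioc A' t = ∅ := Finset.Ioc_eq_empty (by omega)
    have h2 : t - A' = 0 := by omega
    rw [h1, Finset.filter_empty, Finset.sum_empty, h2]
    simpa using hRHS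
  rw [sum_wpair_eq_sum_windowCount hn₁ hn₂ l₁ l₂ A' t, Nat.cast_sub hAt]
  unfold gfun
  set d := Nat.gcd n₁ n₂ with hd
  set q := Nat.lcm n₁ n₂ with hq
  set d₂ := dtwo d l₁ l₂ with hd₂
  set c := crtc n₁ n₂ l₁ l₂ with hc
  have hdpos : 0 < d := Nat.gcd_pos_of_pos_left _ (Nat.pos_of_ne_zero hn₁0)
  have hqsf : Squarefree q := by
    -- `[n₁, n₂] = n₁ · (n₂/(n₁, n₂))` with coprime squarefree factors
    -- (cf. `MaynardSieve.squarefree_lcm`, not imported here)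
    obtain ⟨hcop, hlcm⟩ := coprime_div_gcd_of_squarefree hn₂ hn₁0
    rw [hq, hlcm, Nat.squarefree_mul_iff]
    exact ⟨hcop, hn₁, hn₂.squarefree_of_dvd (Nat.div_dvd_of_dvd (Nat.gcd_dvd_right _ _))⟩
  have hd₂d : d₂ ∣ d := dtwo_dvd d l₁ l₂
  have hdq : d ∣ q := (Nat.gcd_dvd_left n₁ n₂).trans (Nat.dvd_lcm_left n₁ n₂)
  have hd₂q : d₂ ∣ q := hd₂d.trans hdq
  have hcq : c < q := (crtc_spec hn₂ hn₁0 l₁ l₂).2.2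
  split_ifs with h2
  · simpa using hRHS
  · have hd₂odd : d₂ % 2 = 1 := Nat.two_dvd_ne_zero.mp h2
    set adm := (Finset.range d₂).filter (fun μ : ℕ =>
      μ.Coprime d₂ ∧ d₂ ∣ omegaOf d₂ c l₁ l₂ μ ^ 2 + 1) with hadm
    have hcard : adm.card = rho d₂ := card_admissible_eq hn₁ hn₂ l₁ l₂ h2
    have hrestr : ∑ μ ∈ Finset.range d₂, (windowCount q q d₂ μ (omegaOf d₂ c l₁ l₂ μ) A' t c : ℝ) =
        ∑ μ ∈ adm, (windowCount q q d₂ μ (omegaOf d₂ c l₁ l₂ μ) A' t c : ℝ) := by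
      rw [hadm, Finset.sum_filter]
      refine Finset.sum_congr rfl fun μ _ => ?_
      split_ifs with hμ
      · rfl
      · rw [not_and_or] at hμ
        rcases hμ with hμ | hμ
        · rw [windowCount_eq_zero_of_not_coprime hd₂q hμ, Nat.cast_zero]
        · rw [windowCount_eq_zero_of_not_root hd₂q hμ, Nat.cast_zero]
    rw [hrestr]
    set main : ℝ := 1 / q * (rho (q / d₂) : ℝ) * (kappa q G E / Nat.totient d₂) * ((t : ℝ) - A')
      with hmain
    have hper : ∀ μ ∈ adm,
        |(windowCount q q d₂ μ (omegaOf d₂ c l₁ l₂ μ) A' t c : ℝ) - main| ≤ wErr C ε q d A' B₀ E := by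
      intro μ hμ
      have hμ' := hμ
      rw [hadm, Finset.mem_filter] at hμ'
      have h := (hC q q d₂ μ (omegaOf d₂ c l₁ l₂ μ) A' t c E G hqsf dvd_rfl hd₂q hd₂odd hμ'.2.1
        hμ'.2.2 hA hAt hcq hE hEA ((Nat.sqrt_le_sqrt htB).trans hG)).1
      refine h.trans (windowErr_le_wErr hC0 hε.le hqsf hdpos hd₂d hd₂q ?_ hE htB)
      rw [← hcard]
      exact Finset.card_pos.mpr ⟨μ, hμ⟩
    have hsum : |∑ μ ∈ adm, ((windowCount q q d₂ μ (omegaOf d₂ c l₁ l₂ μ) A' t c : ℝ) - main)| ≤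
        adm.card * wErr C ε q d A' B₀ E := by
      calc _ ≤ ∑ μ ∈ adm, |(windowCount q q d₂ μ (omegaOf d₂ c l₁ l₂ μ) A' t c : ℝ) - main| :=
            Finset.abs_sum_le_sum_abs _ _
        _ ≤ ∑ μ ∈ adm, wErr C ε q d A' B₀ E := Finset.sum_le_sum hper
        _ = _ := by rw [Finset.sum_const, nsmul_eq_mul]
    have hmain_eq : (adm.card : ℝ) * main =
        (rho q : ℝ) / q * kappa q G E * (1 / (Nat.totient d₂ : ℝ)) * ((t : ℝ) - A') := by
      rw [hcard, hmain]
      have hρ : (rho (q / d₂) : ℝ) * rho d₂ = rho q := by exact_mod_cast rho_div_mul_rho hqsf hd₂q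
      rw [← hρ]; ring
    have hcardle : (adm.card : ℝ) ≤ d.divisors.card := by
      rw [hcard]
      exact_mod_cast (rho_le_card_divisors d₂).trans
        (Finset.card_le_card (Nat.divisors_subset_of_dvd hdpos.ne' hd₂d))
    calc |∑ μ ∈ adm, (windowCount q q d₂ μ (omegaOf d₂ c l₁ l₂ μ) A' t c : ℝ) -
            (rho q : ℝ) / q * kappa q G E * (1 / (Nat.totient d₂ : ℝ)) * ((t : ℝ) - A')|
        = |∑ μ ∈ adm, ((windowCount q q d₂ μ (omegaOf d₂ c l₁ l₂ μ) A' t c : ℝ) - main)| := by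
          rw [Finset.sum_sub_distrib, Finset.sum_const, nsmul_eq_mul, hmain_eq]
      _ ≤ adm.card * wErr C ε q d A' B₀ E := hsum
      _ ≤ d.divisors.card * wErr C ε q d A' B₀ E :=
          mul_le_mul_of_nonneg_right hcardle (wErr_nonneg hC0 ε q d A' B₀ E)

/-! ### The evaluation of `W` -/

/-- **`W` against its main term, upper and lower bounds** (p. 183–184, in the `m`-first form):
with `Msf = {A' < m ≤ B₀ : (m, n₁) = (m, n₂) = 1}`, `q = [n₁,n₂]`, `d = (n₁,n₂)`, `κ = kappa q G E`,
`L = ⌊X/(A'+1)⌋`: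
`W ≤ (ρ(q)/q) κ ∑_{A'<m≤B₀} ∑_{l₁,l₂ ≤ ⌊X/m⌋} g(l₁,l₂) + (L+1)² τ(d) wErr` and
`(ρ(q)/q) κ ∑_{A'<m≤B₀} ∑_{l₁,l₂ < ⌊X/m⌋} g(l₁,l₂) − (L+1)² τ(d) wErr ≤ W`
(per pair `(l₁, l₂)`: `sum_wpair_linear` on `A' < m ≤ min(B₀, X/(lᵢ+θ))`; the two sandwiches
`le_sum_xcount_mul`/`sum_xcount_mul_le`). [cite: IwaniecInventiones1978, §4 pp. 183–184] -/
theorem wsum_bounds (h6 : lemma6_hooley) {ε : ℝ} (hε : 0 < ε) :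
    ∃ C : ℝ, 0 ≤ C ∧ ∀ (X n₁ n₂ A' B₀ E G : ℕ), Squarefree n₁ → Squarefree n₂ → 2 ≤ A' →
      1 ≤ E → E ≤ A' → Nat.sqrt B₀ ≤ G →
      ((wsum X ((Finset.Ioc A' B₀).filter (fun m : ℕ => n₁.Coprime m ∧ n₂.Coprime m)) n₁ n₂ : ℝ) ≤
          (rho (Nat.lcm n₁ n₂) : ℝ) / Nat.lcm n₁ n₂ * kappa (Nat.lcm n₁ n₂) G E *
              ∑ m ∈ Finset.Ioc A' B₀, ∑ l₁ ∈ Finset.range (X / m + 1),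
                ∑ l₂ ∈ Finset.range (X / m + 1), gfun (Nat.gcd n₁ n₂) l₁ l₂ +
            ((X / (A' + 1) + 1 : ℕ) : ℝ) ^ 2 * (((Nat.gcd n₁ n₂).divisors.card : ℝ) *
              wErr C ε (Nat.lcm n₁ n₂) (Nat.gcd n₁ n₂) A' B₀ E)) ∧
      ((rho (Nat.lcm n₁ n₂) : ℝ) / Nat.lcm n₁ n₂ * kappa (Nat.lcm n₁ n₂) G E *
              ∑ m ∈ Finset.Ioc A' B₀, ∑ l₁ ∈ Finset.range (X / m),
                ∑ l₂ ∈ Finset.range (X / m), gfun (Nat.gcd n₁ n₂) l₁ l₂ -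
            ((X / (A' + 1) + 1 : ℕ) : ℝ) ^ 2 * (((Nat.gcd n₁ n₂).divisors.card : ℝ) *
              wErr C ε (Nat.lcm n₁ n₂) (Nat.gcd n₁ n₂) A' B₀ E) ≤
          (wsum X ((Finset.Ioc A' B₀).filter (fun m : ℕ => n₁.Coprime m ∧ n₂.Coprime m)) n₁ n₂ : ℝ)) := by
  obtain ⟨C, hC0, hC⟩ := sum_wpair_linear h6 hε
  refine ⟨C, hC0, ?_⟩
  intro X n₁ n₂ A' B₀ E G hn₁ hn₂ hA hE hEA hG
  set Msf := (Finset.Ioc A' B₀).filter (fun m : ℕ => n₁.Coprime m ∧ n₂.Coprime m) with hMsf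
  set eκ : ℝ := (rho (Nat.lcm n₁ n₂) : ℝ) / Nat.lcm n₁ n₂ * kappa (Nat.lcm n₁ n₂) G E with heκ
  set Err : ℝ := ((Nat.gcd n₁ n₂).divisors.card : ℝ) *
    wErr C ε (Nat.lcm n₁ n₂) (Nat.gcd n₁ n₂) A' B₀ E with hErr
  set Lmax : ℕ := X / (A' + 1) with hLmax
  -- the per-pair estimate
  have hlayer : ∀ l₁ l₂ t, t ≤ B₀ →
      |∑ m ∈ (Finset.Ioc A' t).filter (fun m : ℕ => n₁.Coprime m ∧ n₂.Coprime m),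
          (wpair m n₁ n₂ l₁ l₂ : ℝ) - eκ * gfun (Nat.gcd n₁ n₂) l₁ l₂ * (((t - A' : ℕ) : ℝ))| ≤ Err := by
    intro l₁ l₂ t ht
    rw [heκ, hErr]
    exact hC n₁ n₂ A' B₀ t E G l₁ l₂ hn₁ hn₂ hA ht hE hEA hG
  have hL : ∀ m ∈ Msf, X / m + 1 ≤ Lmax + 1 := by
    intro m hm
    rw [hMsf, Finset.mem_filter, Finset.mem_Ioc] at hm
    exact Nat.succ_le_succ (Nat.div_le_div_left (by omega) (by omega))
  have hL' : ∀ m ∈ Msf, X / m ≤ Lmax + 1 := fun m hm => (Nat.le_succ _).trans (hL m hm)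
  have hLall : ∀ m ∈ Finset.Ioc A' B₀, X / m + 1 ≤ Lmax + 1 := by
    intro m hm
    rw [Finset.mem_Ioc] at hm
    exact Nat.succ_le_succ (Nat.div_le_div_left (by omega) (by omega))
  have hLall' : ∀ m ∈ Finset.Ioc A' B₀, X / m ≤ Lmax + 1 :=
    fun m hm => (Nat.le_succ _).trans (hLall m hm)
  -- the filtered `m`-ranges of the layers
  have hIocP : ∀ l₁ l₂, (Finset.Ioc A' B₀).filter (fun m => l₁ < X / m + 1 ∧ l₂ < X / m + 1) =
      Finset.Ioc A' (bPlus (bPlus B₀ X l₁) X l₂) := by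
    intro l₁ l₂
    rw [← filter_Ioc_lt_div_add_one, ← filter_Ioc_lt_div_add_one, Finset.filter_filter]
  have hIocM : ∀ l₁ l₂, (Finset.Ioc A' B₀).filter (fun m => l₁ < X / m ∧ l₂ < X / m) =
      Finset.Ioc A' (bMinus (bMinus B₀ X l₁) X l₂) := by
    intro l₁ l₂
    rw [← filter_Ioc_lt_div, ← filter_Ioc_lt_div, Finset.filter_filter]
  have hfilP : ∀ l₁ l₂, Msf.filter (fun m => l₁ < X / m + 1 ∧ l₂ < X / m + 1) =
      (Finset.Ioc A' (bPlus (bPlus B₀ X l₁) X l₂)).filter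
        (fun m : ℕ => n₁.Coprime m ∧ n₂.Coprime m) := by
    intro l₁ l₂
    rw [← hIocP, hMsf, Finset.filter_filter, Finset.filter_filter]
    exact Finset.filter_congr fun m _ => by tauto
  have hfilM : ∀ l₁ l₂, Msf.filter (fun m => l₁ < X / m ∧ l₂ < X / m) =
      (Finset.Ioc A' (bMinus (bMinus B₀ X l₁) X l₂)).filter
        (fun m : ℕ => n₁.Coprime m ∧ n₂.Coprime m) := by
    intro l₁ l₂
    rw [← hIocM, hMsf, Finset.filter_filter, Finset.filter_filter]
    exact Finset.filter_congr fun m _ => by tauto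
  have hBP : ∀ l₁ l₂, bPlus (bPlus B₀ X l₁) X l₂ ≤ B₀ :=
    fun l₁ l₂ => (bPlus_le _ _ _).trans (bPlus_le _ _ _)
  have hBM : ∀ l₁ l₂, bMinus (bMinus B₀ X l₁) X l₂ ≤ B₀ :=
    fun l₁ l₂ => (bMinus_le _ _ _).trans (bMinus_le _ _ _)
  constructor
  · -- Upper bound
    have hWle : (wsum X Msf n₁ n₂ : ℝ) ≤ ∑ m ∈ Msf, ∑ l₁ ∈ Finset.range (X / m + 1),
        ∑ l₂ ∈ Finset.range (X / m + 1), (wpair m n₁ n₂ l₁ l₂ : ℝ) := by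
      unfold wsum
      push_cast
      refine Finset.sum_le_sum fun m _ => ?_
      exact_mod_cast sum_xcount_mul_le X m n₁ n₂
    refine hWle.trans ?_
    rw [sum_sum_sum_range_comm Msf (fun m => X / m + 1) hL]
    have hmain : ∑ m ∈ Finset.Ioc A' B₀, ∑ l₁ ∈ Finset.range (X / m + 1),
        ∑ l₂ ∈ Finset.range (X / m + 1), gfun (Nat.gcd n₁ n₂) l₁ l₂ =
        ∑ l₁ ∈ Finset.range (Lmax + 1), ∑ l₂ ∈ Finset.range (Lmax + 1),
          gfun (Nat.gcd n₁ n₂) l₁ l₂ * (((bPlus (bPlus B₀ X l₁) X l₂ - A' : ℕ) : ℝ)) := by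
      rw [sum_sum_sum_range_comm (Finset.Ioc A' B₀) (fun m => X / m + 1) hLall]
      refine Finset.sum_congr rfl fun l₁ _ => Finset.sum_congr rfl fun l₂ _ => ?_
      rw [Finset.sum_const, nsmul_eq_mul, hIocP l₁ l₂, Nat.card_Ioc, mul_comm]
    rw [hmain, Finset.mul_sum]
    have hstep : ∀ l₁ ∈ Finset.range (Lmax + 1),
        ∑ l₂ ∈ Finset.range (Lmax + 1), ∑ m ∈ Msf.filter (fun m => l₁ < X / m + 1 ∧ l₂ < X / m + 1),
            (wpair m n₁ n₂ l₁ l₂ : ℝ) ≤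
          eκ * ∑ l₂ ∈ Finset.range (Lmax + 1),
              gfun (Nat.gcd n₁ n₂) l₁ l₂ * (((bPlus (bPlus B₀ X l₁) X l₂ - A' : ℕ) : ℝ)) +
            ((Lmax + 1 : ℕ) : ℝ) * Err := by
      intro l₁ _
      have hin : ∀ l₂ ∈ Finset.range (Lmax + 1),
          ∑ m ∈ Msf.filter (fun m => l₁ < X / m + 1 ∧ l₂ < X / m + 1), (wpair m n₁ n₂ l₁ l₂ : ℝ) ≤
            eκ * (gfun (Nat.gcd n₁ n₂) l₁ l₂ * (((bPlus (bPlus B₀ X l₁) X l₂ - A' : ℕ) : ℝ))) + Err := by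
        intro l₂ _
        rw [hfilP l₁ l₂]
        have h := hlayer l₁ l₂ (bPlus (bPlus B₀ X l₁) X l₂) (hBP l₁ l₂)
        have := (abs_le.mp h).2
        linarith
      calc _ ≤ ∑ l₂ ∈ Finset.range (Lmax + 1),
            (eκ * (gfun (Nat.gcd n₁ n₂) l₁ l₂ * (((bPlus (bPlus B₀ X l₁) X l₂ - A' : ℕ) : ℝ))) + Err) :=
            Finset.sum_le_sum hin
        _ = _ := by
            rw [Finset.sum_add_distrib, Finset.sum_const, Finset.card_range, nsmul_eq_mul,
              ← Finset.mul_sum]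
    calc _ ≤ ∑ l₁ ∈ Finset.range (Lmax + 1), (eκ * ∑ l₂ ∈ Finset.range (Lmax + 1),
              gfun (Nat.gcd n₁ n₂) l₁ l₂ * (((bPlus (bPlus B₀ X l₁) X l₂ - A' : ℕ) : ℝ)) +
            ((Lmax + 1 : ℕ) : ℝ) * Err) := Finset.sum_le_sum hstep
      _ = _ := by
          rw [Finset.sum_add_distrib, Finset.sum_const, Finset.card_range, nsmul_eq_mul]
          push_cast
          ring
  · -- Lower bound
    have hWge : ∑ m ∈ Msf, ∑ l₁ ∈ Finset.range (X / m), ∑ l₂ ∈ Finset.range (X / m),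
        (wpair m n₁ n₂ l₁ l₂ : ℝ) ≤ (wsum X Msf n₁ n₂ : ℝ) := by
      unfold wsum
      push_cast
      refine Finset.sum_le_sum fun m hm => ?_
      have hm2 : 2 ≤ m := by rw [hMsf, Finset.mem_filter, Finset.mem_Ioc] at hm; omega
      exact_mod_cast le_sum_xcount_mul X hm2 n₁ n₂
    refine le_trans ?_ hWge
    rw [sum_sum_sum_range_comm Msf (fun m => X / m) hL']
    have hmain : ∑ m ∈ Finset.Ioc A' B₀, ∑ l₁ ∈ Finset.range (X / m),
        ∑ l₂ ∈ Finset.range (X / m), gfun (Nat.gcd n₁ n₂) l₁ l₂ =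
        ∑ l₁ ∈ Finset.range (Lmax + 1), ∑ l₂ ∈ Finset.range (Lmax + 1),
          gfun (Nat.gcd n₁ n₂) l₁ l₂ * (((bMinus (bMinus B₀ X l₁) X l₂ - A' : ℕ) : ℝ)) := by
      rw [sum_sum_sum_range_comm (Finset.Ioc A' B₀) (fun m => X / m) hLall']
      refine Finset.sum_congr rfl fun l₁ _ => Finset.sum_congr rfl fun l₂ _ => ?_
      rw [Finset.sum_const, nsmul_eq_mul, hIocM l₁ l₂, Nat.card_Ioc, mul_comm]
    rw [hmain, Finset.mul_sum]
    have hstep : ∀ l₁ ∈ Finset.range (Lmax + 1),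
        eκ * ∑ l₂ ∈ Finset.range (Lmax + 1),
              gfun (Nat.gcd n₁ n₂) l₁ l₂ * (((bMinus (bMinus B₀ X l₁) X l₂ - A' : ℕ) : ℝ)) -
            ((Lmax + 1 : ℕ) : ℝ) * Err ≤
          ∑ l₂ ∈ Finset.range (Lmax + 1), ∑ m ∈ Msf.filter (fun m => l₁ < X / m ∧ l₂ < X / m),
            (wpair m n₁ n₂ l₁ l₂ : ℝ) := by
      intro l₁ _
      have hin : ∀ l₂ ∈ Finset.range (Lmax + 1),
          eκ * (gfun (Nat.gcd n₁ n₂) l₁ l₂ * (((bMinus (bMinus B₀ X l₁) X l₂ - A' : ℕ) : ℝ))) - Err ≤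
            ∑ m ∈ Msf.filter (fun m => l₁ < X / m ∧ l₂ < X / m), (wpair m n₁ n₂ l₁ l₂ : ℝ) := by
        intro l₂ _
        rw [hfilM l₁ l₂]
        have h := hlayer l₁ l₂ (bMinus (bMinus B₀ X l₁) X l₂) (hBM l₁ l₂)
        have := (abs_le.mp h).1
        linarith
      calc _ = ∑ l₂ ∈ Finset.range (Lmax + 1),
            (eκ * (gfun (Nat.gcd n₁ n₂) l₁ l₂ * (((bMinus (bMinus B₀ X l₁) X l₂ - A' : ℕ) : ℝ))) - Err) := by
            rw [Finset.sum_sub_distrib, Finset.sum_const, Finset.card_range, nsmul_eq_mul,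
              ← Finset.mul_sum]
        _ ≤ _ := Finset.sum_le_sum hin
    calc _ = ∑ l₁ ∈ Finset.range (Lmax + 1), (eκ * ∑ l₂ ∈ Finset.range (Lmax + 1),
              gfun (Nat.gcd n₁ n₂) l₁ l₂ * (((bMinus (bMinus B₀ X l₁) X l₂ - A' : ℕ) : ℝ)) -
            ((Lmax + 1 : ℕ) : ℝ) * Err) := by
          rw [Finset.sum_sub_distrib, Finset.sum_const, Finset.card_range, nsmul_eq_mul]
          push_cast
          ring
      _ ≤ _ := Finset.sum_le_sum hstep

end Literature.NumberTheory.Sieve.Iwaniec1978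

end
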